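import Summits.AnomalousDissipation.AnomalousDissipation.Theorems.MomentParityPlanarCubicQuietRow

/-!
# `MomentParity.PlanarCubicQuiet` (stmt-AnomalousDissipation-11468), II: planar 3-stationary level-`N`
# measures are quiet, `ε(μ) ≤ ‖Δf‖₂^{1/2} E^{3/4} ν^{1/2}` (Alexakis–Doering as the enstrophy row)

On `𝕋²`, for a smooth divergence-free mean-zero force `f` and an energy budget `E ≥ 0`, every
probability measure on `H` carried by level-`N` Fourier–Galerkin fields, with finite third moments,
which is 3-stationary for Galerkin Navier–Stokes at `(ν, f)` (all polynomial cylindrical observables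
of degree `≤ 2` with band-limited tests are drift-free) and has mean energy `≤ E`, dissipates at most
`C √ν` with `C = √E · √(‖Δf‖₂ √E)` INDEPENDENT of `ν`, `N` and the measure
(`planarCubicQuiet_proof`).

Proof (Alexakis–Doering 2006, §2, transplanted to the moment formalism; the row algebra is in the
support file `MomentParityPlanarCubicQuietRow.lean`):

* the ENSTROPHY ROW of 3-stationarity, tested against `A P_N u`, reads on level-`N` fields of `𝕋²`
  `ν ∫ ‖A u‖² dμ = ∫ (f, A u) dμ = -∫ (Δf, u) dμ ≤ ‖Δf‖₂ √E` (`abs_integral_inner_stokesTruncate_le`);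
* interpolation on the modes, `‖∇u‖² ≤ |u| ‖Au‖` (`gradSum_le_norm_mul_sqrt`), and Cauchy–Schwarz in
  `L²(μ)` give `ν ∫ ‖∇u‖² dμ ≤ ν √E (∫‖Au‖²)^{1/2} ≤ √ν √E √(‖Δf‖₂ √E)`
  (`ensembleDissipation_le_of_enstrophyRow`).

References: A. Alexakis, C. Doering, Phys. Lett. A 359 (2006) 652–657, §2; C. Foias, O. Manley,
R. Rosa, R. Temam, *Navier–Stokes Equations and Turbulence* (CUP 2001), Ch. IV §1.2, App. II.A (A.62).
-/

noncomputable section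

-- `Summit.<Summit>.<Problem>` is the tree's mandated summit-side namespace (CONVENTIONS §2); for this
-- single-conjunct summit the two coincide, so the duplicate is deliberate.
set_option linter.dupNamespace false

namespace Summit.AnomalousDissipation.AnomalousDissipation.Theorems

open MeasureTheory Filter UnitAddTorus
open scoped InnerProductSpace RealInnerProductSpace ENNReal
open Literature.Analysis.FunctionSpaces Literature.Analysis.FluidPDE
open Summit.AnomalousDissipation.AnomalousDissipation.Theses.MomentParity

namespace PlanarCubicQuiet

variable {d : Type*} [Fintype d] [DecidableEq d]

/-! ## Bessel, interpolation and the force term on `H` -/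

/-- **Bessel for the truncation on `H`**: `Σ_{|k|≤N} ‖û(k)‖² ≤ ‖u‖²`. [folklore] -/
theorem sum_sq_norm_mFourierCoeff_le (N : ℕ) (u : Torus.energySpace d) :
    ∑ k ∈ Torus.freqBall N, ‖mFourierCoeff (EuclideanSpace.complexify ∘ ((u : Lp (EuclideanSpace ℝ d) 2 (volume : Measure (UnitAddTorus d))) : (UnitAddTorus d → EuclideanSpace ℝ d))) k‖ ^ 2 ≤
      ‖u‖ ^ 2 := by
  have hmem : MemLp ((u : Lp (EuclideanSpace ℝ d) 2 (volume : Measure (UnitAddTorus d))) : (UnitAddTorus d → EuclideanSpace ℝ d)) 2 volume := Lp.memLp (u : Lp (EuclideanSpace ℝ d) 2 (volume : Measure (UnitAddTorus d)))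
  have h := Torus.integral_norm_sq_fourierTruncate_le hmem N
  rw [Torus.integral_norm_sq_fourierTruncate (hmem.integrable one_le_two),
    Torus.integral_norm_sq_coe_eq] at h
  exact h

/-- **Interpolation on the modes**: `4π² Σ_{|k|≤N} |k|² ‖û(k)‖² ≤ ‖u‖ (16π⁴ Σ |k|⁴ ‖û(k)‖²)^{1/2}`,
i.e. `‖∇P_N u‖² ≤ |u| ‖A P_N u‖` (Cauchy–Schwarz). [folklore] -/
theorem gradSum_le_norm_mul_sqrt (N : ℕ) (u : Torus.energySpace d) :
    4 * Real.pi ^ 2 * ∑ k ∈ Torus.freqBall N, Torus.freqNormSq k *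
        ‖mFourierCoeff (EuclideanSpace.complexify ∘ ((u : Lp (EuclideanSpace ℝ d) 2 (volume : Measure (UnitAddTorus d))) : (UnitAddTorus d → EuclideanSpace ℝ d))) k‖ ^ 2 ≤
      ‖u‖ * Real.sqrt (∑ k ∈ Torus.freqBall N, (4 * Real.pi ^ 2 * Torus.freqNormSq k) ^ 2 *
        ‖mFourierCoeff (EuclideanSpace.complexify ∘ ((u : Lp (EuclideanSpace ℝ d) 2 (volume : Measure (UnitAddTorus d))) : (UnitAddTorus d → EuclideanSpace ℝ d))) k‖ ^ 2) := by
  set c : (d → ℤ) → ℝ := fun k => ‖mFourierCoeff (EuclideanSpace.complexify ∘ ((u : Lp (EuclideanSpace ℝ d) 2 (volume : Measure (UnitAddTorus d))) : (UnitAddTorus d → EuclideanSpace ℝ d))) k‖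
    with hc
  have h := Real.sum_mul_le_sqrt_mul_sqrt (Torus.freqBall N) c
    (fun k => 4 * Real.pi ^ 2 * Torus.freqNormSq k * c k)
  have hlhs : 4 * Real.pi ^ 2 * ∑ k ∈ Torus.freqBall N, Torus.freqNormSq k * c k ^ 2 =
      ∑ k ∈ Torus.freqBall N, c k * (4 * Real.pi ^ 2 * Torus.freqNormSq k * c k) := by
    rw [Finset.mul_sum]
    exact Finset.sum_congr rfl fun k _ => by ring
  have hrhs : ∑ k ∈ Torus.freqBall N, (4 * Real.pi ^ 2 * Torus.freqNormSq k * c k) ^ 2 =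
      ∑ k ∈ Torus.freqBall N, (4 * Real.pi ^ 2 * Torus.freqNormSq k) ^ 2 * c k ^ 2 :=
    Finset.sum_congr rfl fun k _ => by ring
  rw [hlhs]
  refine h.trans ?_
  rw [hrhs]
  refine mul_le_mul_of_nonneg_right ?_ (Real.sqrt_nonneg _)
  rw [Real.sqrt_le_left (norm_nonneg _)]
  exact sum_sq_norm_mFourierCoeff_le N u

/-- **The force term of the enstrophy row**: for smooth `f` and `v ∈ L²`,
`|∫ ⟪f, A P_N v⟫| = |∫ ⟪Δf, P_N v⟫| ≤ ‖Δf‖₂ ‖v‖₂` (Green's identity, Cauchy–Schwarz, Bessel).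
[folklore] -/
theorem abs_integral_inner_stokesTruncate_le {f : (UnitAddTorus d → EuclideanSpace ℝ d)} (hf : Torus.IsSmooth f) (N : ℕ) (u : Torus.energySpace d) :
    |∫ x, ⟪f x, Torus.realTrigPoly (Torus.freqBall N)
        (fun k => (((4 * Real.pi ^ 2 * Torus.freqNormSq k : ℝ)) : ℂ) •
          mFourierCoeff (EuclideanSpace.complexify ∘ ((u : Lp (EuclideanSpace ℝ d) 2 (volume : Measure (UnitAddTorus d))) : (UnitAddTorus d → EuclideanSpace ℝ d))) k) x⟫_ℝ| ≤
      Real.sqrt (∫ x, ‖Torus.laplacian f x‖ ^ 2) * ‖u‖ := by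
  set v : (UnitAddTorus d → EuclideanSpace ℝ d) := ((u : Lp (EuclideanSpace ℝ d) 2 (volume : Measure (UnitAddTorus d))) : (UnitAddTorus d → EuclideanSpace ℝ d)) with hv
  set w := Torus.fourierTruncate N v with hw_def
  have hmem : MemLp v 2 volume := Lp.memLp (u : Lp (EuclideanSpace ℝ d) 2 (volume : Measure (UnitAddTorus d)))
  have hw : Torus.IsSmooth w := Torus.isSmooth_fourierTruncate N v
  have hwmem : MemLp w 2 volume := Torus.memLp_fourierTruncate N v 2
  have hlapmem : MemLp (Torus.laplacian f) 2 volume := hf.laplacian.memLp 2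
  -- Green: `∫ ⟪f, -Δw⟫ = -∫ ⟪Δf, w⟫`
  have h1 : ∫ x, ⟪f x, Torus.realTrigPoly (Torus.freqBall N)
      (fun k => (((4 * Real.pi ^ 2 * Torus.freqNormSq k : ℝ)) : ℂ) •
        mFourierCoeff (EuclideanSpace.complexify ∘ v) k) x⟫_ℝ = -∫ x, ⟪Torus.laplacian f x, w x⟫_ℝ := by
    simp_rw [stokesTruncate_eq_neg_laplacian, inner_neg_right, integral_neg]
    rw [← Torus.integral_inner_laplacian_comm hf hw]
  rw [h1, abs_neg]
  -- Cauchy–Schwarz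
  have h2 : |∫ x, ⟪Torus.laplacian f x, w x⟫_ℝ| ≤ ∫ x, ‖Torus.laplacian f x‖ * ‖w x‖ := by
    rw [← Real.norm_eq_abs]
    refine norm_integral_le_of_norm_le ?_ (ae_of_all _ fun x => norm_inner_le_norm _ _)
    have h : MemLp ((fun x => ‖w x‖) * fun x => ‖Torus.laplacian f x‖) 1 volume :=
      hlapmem.norm.mul hwmem.norm
    refine (memLp_one_iff_integrable.1 h).congr (ae_of_all _ fun x => ?_)
    simp only [Pi.mul_apply]
    ring
  have h3 : ∫ x, ‖Torus.laplacian f x‖ * ‖w x‖ ≤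
      Real.sqrt (∫ x, ‖Torus.laplacian f x‖ ^ 2) * Real.sqrt (∫ x, ‖w x‖ ^ 2) := by
    have h := integral_mul_norm_le_Lp_mul_Lq (μ := volume) Real.HolderConjugate.two_two
      (f := Torus.laplacian f) (g := w) (by simpa using hlapmem) (by simpa using hwmem)
    refine h.trans (le_of_eq ?_)
    rw [← Real.sqrt_eq_rpow, ← Real.sqrt_eq_rpow]
    simp only [Real.rpow_two]
  have h4 : Real.sqrt (∫ x, ‖w x‖ ^ 2) ≤ ‖u‖ := by
    rw [Real.sqrt_le_left (norm_nonneg _), hw_def,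
      Torus.integral_norm_sq_fourierTruncate (hmem.integrable one_le_two)]
    exact sum_sq_norm_mFourierCoeff_le N u
  exact h2.trans (h3.trans (mul_le_mul_of_nonneg_left h4 (Real.sqrt_nonneg _)))

/-! ## Moments and continuity on `H` -/

/-- On a finite measure, `Integrable ‖u‖³ ⇒ Integrable ‖u‖ᵖ` for `p ≤ 3` (moments of order `≤ 3`
from the cube: `t ^ p ≤ 1 + t ^ 3` for `0 ≤ t`). [folklore] -/
theorem integrable_norm_pow_of_cube {μ : Measure (Torus.energySpace d)} [IsFiniteMeasure μ]
    (h3 : Integrable (fun u : Torus.energySpace d => ‖u‖ ^ 3) μ) {p : ℕ} (hp : p ≤ 3) :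
    Integrable (fun u : Torus.energySpace d => ‖u‖ ^ p) μ := by
  refine Integrable.mono' ((integrable_const (1 : ℝ)).add h3)
    (continuous_norm.pow p).aestronglyMeasurable (ae_of_all _ fun u => ?_)
  rw [Real.norm_eq_abs, abs_of_nonneg (by positivity), Pi.add_apply]
  rcases le_or_gt ‖u‖ 1 with h | h
  · calc ‖u‖ ^ p ≤ 1 := pow_le_one₀ (norm_nonneg u) h
      _ ≤ 1 + ‖u‖ ^ 3 := le_add_of_nonneg_right (by positivity)
  · calc ‖u‖ ^ p ≤ ‖u‖ ^ 3 := pow_le_pow_right₀ h.le hp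
      _ ≤ 1 + ‖u‖ ^ 3 := le_add_of_nonneg_left zero_le_one

/-- `(∫ ‖u‖ dμ)² ≤ ∫ ‖u‖² dμ` on a probability space (the variance is non-negative). [folklore] -/
theorem sq_integral_norm_le {μ : Measure (Torus.energySpace d)} [IsProbabilityMeasure μ]
    (h2 : Integrable (fun u : Torus.energySpace d => ‖u‖ ^ 2) μ) :
    (∫ u, ‖u‖ ∂μ) ^ 2 ≤ ∫ u, ‖u‖ ^ 2 ∂μ := by
  have h1 : Integrable (fun u : Torus.energySpace d => ‖u‖) μ := by
    refine Integrable.mono' ((integrable_const (1 : ℝ)).add h2)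
      continuous_norm.aestronglyMeasurable (ae_of_all _ fun u => ?_)
    rw [Real.norm_eq_abs, abs_of_nonneg (norm_nonneg _), Pi.add_apply]
    nlinarith [norm_nonneg u, sq_nonneg (‖u‖ - 1)]
  set a : ℝ := ∫ u, ‖u‖ ∂μ with ha
  have hvar : 0 ≤ ∫ u, (‖u‖ - a) ^ 2 ∂μ := integral_nonneg fun _ => sq_nonneg _
  have hexp : ∫ u, (‖u‖ - a) ^ 2 ∂μ = (∫ u, ‖u‖ ^ 2 ∂μ) - a ^ 2 := by
    have hsplit : (fun u : Torus.energySpace d => (‖u‖ - a) ^ 2) = fun u => ‖u‖ ^ 2 - (2 * a) * ‖u‖ + a ^ 2 := by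
      funext u; ring
    have hA : Integrable (fun u : Torus.energySpace d => ‖u‖ ^ 2 - 2 * a * ‖u‖) μ := h2.sub (h1.const_mul _)
    rw [hsplit, integral_add hA (integrable_const _), integral_sub h2 (h1.const_mul _),
      integral_const_mul, integral_const, ← ha]
    simp only [smul_eq_mul, probReal_univ, one_mul]
    ring
  linarith

/-- Each Fourier coefficient `u ↦ û(k)` is continuous on `H`. [folklore] -/
theorem continuous_mFourierCoeff_coe (k : d → ℤ) :
    Continuous fun u : Torus.energySpace d => mFourierCoeff (EuclideanSpace.complexify ∘ ((u : Lp (EuclideanSpace ℝ d) 2 (volume : Measure (UnitAddTorus d))) : (UnitAddTorus d → EuclideanSpace ℝ d))) k :=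
  (Torus.continuous_mFourierCoeff_complexify_coe k).comp continuous_subtype_val

/-! ## The Alexakis–Doering bound for 3-stationary level-`N` laws on `𝕋²` -/

/-- **Alexakis–Doering as the enstrophy range condition.** On `𝕋²`, let `f` be smooth, `ν > 0`,
and let `μ` be a probability measure on `H` carried by level-`N` fields, with `‖u‖³` integrable,
whose ENSTROPHY ROW (the generator tested against `A P_N u`, i.e. the order-3 test
`Σᵢ 2π²|kᵢ|² Xᵢ²` over the Galerkin frame) is integrable with zero mean. Then
`ε(μ) = ν ∫ ‖∇u‖² dμ ≤ √e · √(‖Δf‖₂ √e) · √ν`, `e = ∫ |u|² dμ`: the row gives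
`ν ∫ ‖Au‖² = ∫ (f, Au) ≤ ‖Δf‖₂ √e`, and `‖∇u‖² ≤ |u| ‖Au‖` with Cauchy–Schwarz in `L²(μ)`
(Alexakis–Doering 2006, §2: `ε² ≤ ν U² χ` and the palinstrophy balance).
[cite: AlexakisDoering2006PLA, §2] -/
theorem ensembleDissipation_le_of_enstrophyRow {f : (UnitAddTorus (Fin 2) → EuclideanSpace ℝ (Fin 2))} (hf : Torus.IsSmooth f) {ν : ℝ}
    (hν : 0 < ν) {N : ℕ} {μ : Measure (Torus.energySpace (Fin 2))} [IsProbabilityMeasure μ]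
    (hlev : ∀ᵐ u : Torus.energySpace (Fin 2) ∂μ, ∀ k ∉ (Torus.freqBall N).erase (0 : Fin 2 → ℤ),
      mFourierCoeff (EuclideanSpace.complexify ∘ ((u : Lp (EuclideanSpace ℝ (Fin 2)) 2 (volume : Measure (UnitAddTorus (Fin 2)))) : (UnitAddTorus (Fin 2) → EuclideanSpace ℝ (Fin 2)))) k = 0)
    (h3 : Integrable (fun u : Torus.energySpace (Fin 2) => ‖u‖ ^ 3) μ)
    (hrowI : Integrable (fun u : Torus.energySpace (Fin 2) => Torus.nsGeneratorPairing ν f u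
      (Torus.realTrigPoly (Torus.freqBall N)
        (fun k => (((4 * Real.pi ^ 2 * Torus.freqNormSq k : ℝ)) : ℂ) •
          mFourierCoeff (EuclideanSpace.complexify ∘ ((u : Lp (EuclideanSpace ℝ (Fin 2)) 2 (volume : Measure (UnitAddTorus (Fin 2)))) : (UnitAddTorus (Fin 2) → EuclideanSpace ℝ (Fin 2)))) k))) μ)
    (hrow0 : ∫ u, Torus.nsGeneratorPairing ν f u
      (Torus.realTrigPoly (Torus.freqBall N)
        (fun k => (((4 * Real.pi ^ 2 * Torus.freqNormSq k : ℝ)) : ℂ) •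
          mFourierCoeff (EuclideanSpace.complexify ∘ ((u : Lp (EuclideanSpace ℝ (Fin 2)) 2 (volume : Measure (UnitAddTorus (Fin 2)))) : (UnitAddTorus (Fin 2) → EuclideanSpace ℝ (Fin 2)))) k)) ∂μ = 0) :
    Torus.ensembleDissipation ν μ ≤
      Real.sqrt (Torus.ensembleEnergy μ) *
        Real.sqrt (Real.sqrt (∫ x, ‖Torus.laplacian f x‖ ^ 2) * Real.sqrt (Torus.ensembleEnergy μ)) *
        Real.sqrt ν := by
  -- the three functionals: force term `F`, squared Stokes norm `L`, enstrophy `G`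
  set F : Torus.energySpace (Fin 2) → ℝ := fun u => ∫ x, ⟪f x, Torus.realTrigPoly (Torus.freqBall N)
      (fun k => (((4 * Real.pi ^ 2 * Torus.freqNormSq k : ℝ)) : ℂ) •
        mFourierCoeff (EuclideanSpace.complexify ∘ ((u : Lp (EuclideanSpace ℝ (Fin 2)) 2 (volume : Measure (UnitAddTorus (Fin 2)))) : (UnitAddTorus (Fin 2) → EuclideanSpace ℝ (Fin 2)))) k) x⟫_ℝ
    with hF
  set L : Torus.energySpace (Fin 2) → ℝ := fun u => ∑ k ∈ Torus.freqBall N,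
      (4 * Real.pi ^ 2 * Torus.freqNormSq k) ^ 2 *
        ‖mFourierCoeff (EuclideanSpace.complexify ∘ ((u : Lp (EuclideanSpace ℝ (Fin 2)) 2 (volume : Measure (UnitAddTorus (Fin 2)))) : (UnitAddTorus (Fin 2) → EuclideanSpace ℝ (Fin 2)))) k‖ ^ 2 with hL
  set G : Torus.energySpace (Fin 2) → ℝ := fun u => 4 * Real.pi ^ 2 * ∑ k ∈ Torus.freqBall N, Torus.freqNormSq k *
      ‖mFourierCoeff (EuclideanSpace.complexify ∘ ((u : Lp (EuclideanSpace ℝ (Fin 2)) 2 (volume : Measure (UnitAddTorus (Fin 2)))) : (UnitAddTorus (Fin 2) → EuclideanSpace ℝ (Fin 2)))) k‖ ^ 2 with hG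
  set D : ℝ := Real.sqrt (∫ x, ‖Torus.laplacian f x‖ ^ 2) with hD
  set e : ℝ := Torus.ensembleEnergy μ with he
  have hD0 : 0 ≤ D := Real.sqrt_nonneg _
  have hL0 : ∀ u, 0 ≤ L u := fun u => Finset.sum_nonneg fun k _ => by positivity
  have hG0 : ∀ u, 0 ≤ G u := fun u =>
    mul_nonneg (by positivity) (Finset.sum_nonneg fun k _ =>
      mul_nonneg (Torus.freqNormSq_nonneg k) (sq_nonneg _))
  have hGle : ∀ u, G u ≤ ‖u‖ * Real.sqrt (L u) := fun u => gradSum_le_norm_mul_sqrt N u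
  -- moments
  have h2 : Integrable (fun u : Torus.energySpace (Fin 2) => ‖u‖ ^ 2) μ :=
    integrable_norm_pow_of_cube h3 (p := 2) (by norm_num)
  have h1 : Integrable (fun u : Torus.energySpace (Fin 2) => ‖u‖) μ := by
    simpa using integrable_norm_pow_of_cube h3 (p := 1) (by norm_num)
  have he0 : 0 ≤ e := integral_nonneg fun u => by positivity
  have he2 : ∫ u, ‖u‖ ^ 2 ∂μ = e := rfl
  -- (i) the row integrand a.e.
  have hae : (fun u : Torus.energySpace (Fin 2) => Torus.nsGeneratorPairing ν f u
      (Torus.realTrigPoly (Torus.freqBall N)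
        (fun k => (((4 * Real.pi ^ 2 * Torus.freqNormSq k : ℝ)) : ℂ) •
          mFourierCoeff (EuclideanSpace.complexify ∘ ((u : Lp (EuclideanSpace ℝ (Fin 2)) 2 (volume : Measure (UnitAddTorus (Fin 2)))) : (UnitAddTorus (Fin 2) → EuclideanSpace ℝ (Fin 2)))) k))) =ᵐ[μ]
      fun u => F u - ν * L u :=
    hlev.mono fun u hu => nsGeneratorPairing_stokesTruncate_of_level ν f hu
  -- (ii) continuity of the three functionals
  have hcoef := continuous_mFourierCoeff_coe (d := Fin 2)
  have hLcont : Continuous L :=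
    continuous_finsetSum _ fun k _ => continuous_const.mul ((hcoef k).norm.pow 2)
  have hGcont : Continuous G :=
    continuous_const.mul (continuous_finsetSum _ fun k _ => continuous_const.mul ((hcoef k).norm.pow 2))
  have hFcont : Continuous F := by
    have hfi : Integrable f volume := hf.integrable
    have hF' : F = fun u : Torus.energySpace (Fin 2) => ∑ k ∈ Torus.freqBall N,
        (inner ℂ (mFourierCoeff (EuclideanSpace.complexify ∘ f) k)
          ((((4 * Real.pi ^ 2 * Torus.freqNormSq k : ℝ)) : ℂ) •
            mFourierCoeff (EuclideanSpace.complexify ∘ ((u : Lp (EuclideanSpace ℝ (Fin 2)) 2 (volume : Measure (UnitAddTorus (Fin 2)))) : (UnitAddTorus (Fin 2) → EuclideanSpace ℝ (Fin 2)))) k)).re :=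
      funext fun u => Torus.integral_inner_realTrigPoly_of_integrable _ _ hfi
    rw [hF']
    refine continuous_finsetSum _ fun k _ => Complex.continuous_re.comp ?_
    have hk : Continuous fun u : Torus.energySpace (Fin 2) =>
        (((4 * Real.pi ^ 2 * Torus.freqNormSq k : ℝ)) : ℂ) •
          mFourierCoeff (EuclideanSpace.complexify ∘ ((u : Lp (EuclideanSpace ℝ (Fin 2)) 2 (volume : Measure (UnitAddTorus (Fin 2)))) : (UnitAddTorus (Fin 2) → EuclideanSpace ℝ (Fin 2)))) k :=
      (hcoef k).const_smul ((((4 * Real.pi ^ 2 * Torus.freqNormSq k : ℝ)) : ℂ))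
    exact continuous_const.inner hk
  -- (iii) integrability
  have hFle : ∀ u, |F u| ≤ D * ‖u‖ := fun u => abs_integral_inner_stokesTruncate_le hf N u
  have hFint : Integrable F μ :=
    Integrable.mono' (h1.const_mul D) hFcont.aestronglyMeasurable
      (ae_of_all _ fun u => by rw [Real.norm_eq_abs]; exact hFle u)
  have hrow' : Integrable (fun u => F u - ν * L u) μ := hrowI.congr hae
  have hLint : Integrable L μ := by
    have h := (hFint.sub hrow').const_mul ν⁻¹
    refine h.congr (ae_of_all _ fun u => ?_)
    simp only [Pi.sub_apply]
    field_simp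
    ring
  have hsqL : ∀ u, Real.sqrt (L u) ^ 2 = L u := fun u => Real.sq_sqrt (hL0 u)
  have hprod_le : ∀ u, ‖u‖ * Real.sqrt (L u) ≤ (‖u‖ ^ 2 + L u) / 2 := fun u => by
    nlinarith [two_mul_le_add_sq ‖u‖ (Real.sqrt (L u)), hsqL u]
  have hprod_int : Integrable (fun u : Torus.energySpace (Fin 2) => ‖u‖ * Real.sqrt (L u)) μ := by
    refine Integrable.mono' ((h2.add hLint).div_const 2)
      (continuous_norm.mul (Real.continuous_sqrt.comp hLcont)).aestronglyMeasurable
      (ae_of_all _ fun u => ?_)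
    rw [Real.norm_of_nonneg (mul_nonneg (norm_nonneg _) (Real.sqrt_nonneg _))]
    exact hprod_le u
  have hGint : Integrable G μ := by
    refine Integrable.mono' hprod_int hGcont.aestronglyMeasurable (ae_of_all _ fun u => ?_)
    rw [Real.norm_of_nonneg (hG0 u)]
    exact hGle u
  -- (iv) the row: `ν ∫ L = ∫ F ≤ D √e`
  have hrow : ∫ u, (F u - ν * L u) ∂μ = 0 := by
    rw [← integral_congr_ae hae]; exact hrow0
  rw [integral_sub hFint (hLint.const_mul ν), integral_const_mul] at hrow
  have hF_le : ∫ u, F u ∂μ ≤ D * ∫ u, ‖u‖ ∂μ := by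
    rw [← integral_const_mul]
    exact integral_mono hFint (h1.const_mul D) fun u => (le_abs_self _).trans (hFle u)
  have hnorm_le : ∫ u, ‖u‖ ∂μ ≤ Real.sqrt e :=
    (le_abs_self _).trans (Real.abs_le_sqrt (sq_integral_norm_le h2))
  set X : ℝ := ∫ u, L u ∂μ with hX
  have hX0 : 0 ≤ X := integral_nonneg hL0
  have hνX : ν * X ≤ D * Real.sqrt e := by
    have : ν * X = ∫ u, F u ∂μ := by linarith
    rw [this]
    exact hF_le.trans (mul_le_mul_of_nonneg_left hnorm_le hD0)
  -- (v) the dissipation is `ν ∫ G`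
  have hdiss : Torus.ensembleDissipation ν μ = ν * ∫ u, G u ∂μ := by
    unfold Torus.ensembleDissipation Torus.ensembleEnstrophy
    congr 1
    have hae2 : ∀ᵐ u : Torus.energySpace (Fin 2) ∂μ,
        Torus.eGradNormSq ((u : Lp (EuclideanSpace ℝ (Fin 2)) 2 (volume : Measure (UnitAddTorus (Fin 2)))) : (UnitAddTorus (Fin 2) → EuclideanSpace ℝ (Fin 2))) = ENNReal.ofReal (G u) :=
      hlev.mono fun u hu => eGradNormSq_eq_ofReal_of_level hu
    rw [lintegral_congr_ae hae2, ← ofReal_integral_eq_lintegral_ofReal hGint (ae_of_all _ hG0),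
      ENNReal.toReal_ofReal (integral_nonneg hG0)]
  -- (vi) `∫ G ≤ √e √X` (interpolation and Cauchy–Schwarz in `L²(μ)`)
  have hG_le : ∫ u, G u ∂μ ≤ Real.sqrt e * Real.sqrt X := by
    have hmono : ∫ u, G u ∂μ ≤ ∫ u, ‖u‖ * Real.sqrt (L u) ∂μ := integral_mono hGint hprod_int hGle
    have hm1 : MemLp (fun u : Torus.energySpace (Fin 2) => ‖u‖) (ENNReal.ofReal 2) μ := by
      rw [show ENNReal.ofReal (2 : ℝ) = (2 : ℝ≥0∞) by simp]
      exact (memLp_two_iff_integrable_sq continuous_norm.aestronglyMeasurable).2 h2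
    have hm2 : MemLp (fun u : Torus.energySpace (Fin 2) => Real.sqrt (L u)) (ENNReal.ofReal 2) μ := by
      rw [show ENNReal.ofReal (2 : ℝ) = (2 : ℝ≥0∞) by simp]
      exact (memLp_two_iff_integrable_sq (Real.continuous_sqrt.comp hLcont).aestronglyMeasurable).2
        (hLint.congr (ae_of_all _ fun u => (hsqL u).symm))
    have hH := integral_mul_le_Lp_mul_Lq_of_nonneg (μ := μ) Real.HolderConjugate.two_two
      (f := fun u : Torus.energySpace (Fin 2) => ‖u‖) (g := fun u => Real.sqrt (L u))
      (ae_of_all _ fun u => norm_nonneg _) (ae_of_all _ fun u => Real.sqrt_nonneg _) hm1 hm2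
    refine hmono.trans (hH.trans (le_of_eq ?_))
    rw [← Real.sqrt_eq_rpow, ← Real.sqrt_eq_rpow]
    simp only [Real.rpow_two, hsqL, he2]
    rfl
  -- (vii) assemble: `ν √e √X = √e √ν √(νX) ≤ √e √ν √(D √e)`
  rw [hdiss]
  have hstep : ν * ∫ u, G u ∂μ ≤ ν * (Real.sqrt e * Real.sqrt X) :=
    mul_le_mul_of_nonneg_left hG_le hν.le
  have hsplit : ν * Real.sqrt X = Real.sqrt ν * Real.sqrt (ν * X) := by
    rw [← Real.sqrt_mul hν.le, ← mul_assoc, Real.sqrt_mul (mul_self_nonneg ν),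
      Real.sqrt_mul_self hν.le]
  have hkey : Real.sqrt (ν * X) ≤ Real.sqrt (D * Real.sqrt e) := Real.sqrt_le_sqrt hνX
  calc ν * ∫ u, G u ∂μ ≤ ν * (Real.sqrt e * Real.sqrt X) := hstep
    _ = Real.sqrt e * (Real.sqrt ν * Real.sqrt (ν * X)) := by rw [← hsplit]; ring
    _ ≤ Real.sqrt e * (Real.sqrt ν * Real.sqrt (D * Real.sqrt e)) :=
        mul_le_mul_of_nonneg_left (mul_le_mul_of_nonneg_left hkey (Real.sqrt_nonneg _))
          (Real.sqrt_nonneg _)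
    _ = Real.sqrt e * Real.sqrt (D * Real.sqrt e) * Real.sqrt ν := by ring

end PlanarCubicQuiet

open PlanarCubicQuiet in
/-- **`MomentParity.PlanarCubicQuiet` (stmt-AnomalousDissipation-11468).** On `𝕋²`, for every smooth
divergence-free mean-zero force `f` and every `E ≥ 0` there is `C` (namely
`C = √E · √(‖Δf‖₂ √E) = ‖Δf‖₂^{1/2} E^{3/4}`) such that for every `ν > 0`, every level `N` and
every probability measure on `H` carried by level-`N` fields, with finite third moments, which is
3-stationary for Galerkin Navier–Stokes at `(ν, f)` and has mean energy `≤ E`, the dissipation is at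
most `C √ν`: the enstrophy row of quadratic stationarity IS Alexakis–Doering's 2-D bound
(`PlanarCubicQuiet.ensembleDissipation_le_of_enstrophyRow`). [cite: AlexakisDoering2006PLA, §2] -/
theorem planarCubicQuiet_proof : PlanarCubicQuiet := by
  intro f hf _hdiv _hmean E _hE
  refine ⟨Real.sqrt E * Real.sqrt (Real.sqrt (∫ x, ‖Torus.laplacian f x‖ ^ 2) * Real.sqrt E), ?_⟩
  intro ν hν N μ hprob hlev h3 hstat hEn
  -- the enstrophy row is an admissible order-3 test
  obtain ⟨hI, h0⟩ := hstat _ (Torus.galerkinTest (d := Fin 2) N one_pos).g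
    (∑ j : Fin (Torus.galerkinTest (d := Fin 2) N one_pos).m,
      MvPolynomial.C (2 * Real.pi ^ 2 * Torus.freqNormSq
        (((Fintype.equivFin (Torus.FrameIdx (Fin 2) N)).symm j).1 : Fin 2 → ℤ)) *
        MvPolynomial.X j ^ 2)
    (galerkinTest_band N) (totalDegree_sum_C_mul_X_sq _)
  -- its differential is the Stokes truncation `A P_N u`
  have hrow_eq : ∀ u : Torus.energySpace (Fin 2),
      Torus.nsGeneratorPairing ν f u (fun x => ∑ i : Fin (Torus.galerkinTest (d := Fin 2) N one_pos).m,
        (MvPolynomial.eval (fun j => Torus.pairing u.1 ((Torus.galerkinTest (d := Fin 2) N one_pos).g j))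
          (MvPolynomial.pderiv i
            (∑ j : Fin (Torus.galerkinTest (d := Fin 2) N one_pos).m,
              MvPolynomial.C (2 * Real.pi ^ 2 * Torus.freqNormSq
                (((Fintype.equivFin (Torus.FrameIdx (Fin 2) N)).symm j).1 : Fin 2 → ℤ)) *
                MvPolynomial.X j ^ 2 :
                  MvPolynomial (Fin (Torus.galerkinTest (d := Fin 2) N one_pos).m) ℝ))) •
          (Torus.galerkinTest (d := Fin 2) N one_pos).g i x) =
      Torus.nsGeneratorPairing ν f u (Torus.realTrigPoly (Torus.freqBall N)
        (fun k => (((4 * Real.pi ^ 2 * Torus.freqNormSq k : ℝ)) : ℂ) •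
          mFourierCoeff (EuclideanSpace.complexify ∘
            ((u : Lp (EuclideanSpace ℝ (Fin 2)) 2 (volume : Measure (UnitAddTorus (Fin 2)))) :
              UnitAddTorus (Fin 2) → EuclideanSpace ℝ (Fin 2))) k)) :=
    fun u => congrArg _ (funext fun x => polyGrad_stokes N u x)
  simp only [hrow_eq] at hI h0
  have h := ensembleDissipation_le_of_enstrophyRow hf hν hlev h3 hI h0
  refine h.trans ?_
  have hD : 0 ≤ Real.sqrt (∫ x, ‖Torus.laplacian f x‖ ^ 2) := Real.sqrt_nonneg _
  gcongr

end Summit.AnomalousDissipation.AnomalousDissipation.Theorems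

end
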